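import Mathlib
import Summits.KontsevichZagierPeriods.Zeta5Search.Families.BasicGrowth
import HarnessLib

/-!
# ζ(5) search — Families: log-convexity of `N ↦ I_σ(N)` and the RATIO limit `I_σ(N+1)/I_σ(N) ↑ M_σ`

HONEST FRAMING: systematic search; no irrationality claim unless certified.  STRUCTURAL facts about Brown's basic
cellular integrals `I_σ(N) = ∫_{S_n} f_σ^N ω_σ` [Brown2016, §1.5 (1.3)–(1.4)] (seat P2, Families layer); nothing
about the arithmetic of any zeta value.

`Families/BasicGrowth.lean` proved `I_σ(N)^{1/N} → M_σ = sup_S f_σ` (`fSup σ`).  Since `I_σ(N)` is the `N`-th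
moment of the finite measure `ω_σ dt` against `0 < f_σ ≤ 1`, the sequence is LOG-CONVEX, and the ratios converge
monotonically to the same constant — which turns every exactly computed ratio into a CERTIFIED LOWER BOUND for the
growth constant:
* `integral_basic_quad_nonneg` — `c² I_σ(N) − 2c I_σ(N+1) + I_σ(N+2) = ∫ f_σ^N (f_σ − c)² ω_σ ≥ 0`
  for all real `c`;
* **`integral_basic_sq_le_mul`** — `I_σ(N+1)² ≤ I_σ(N) · I_σ(N+2)` (discriminant), i.e. `N ↦ I_σ(N)` is
  log-convex;
* **`integral_basic_ratio_mono`** — the ratios `r_N = I_σ(N+1)/I_σ(N)` are NON-DECREASING;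
* **`integral_basic_ratio_le_fSup`** — `r_N ≤ M_σ` for every `N` (as `f_σ ≤ M_σ` pointwise);
* **`tendsto_integral_basic_ratio`** — `r_N → M_σ`; hence `M_σ = sup_N r_N` (`fSup_eq_ciSup_ratio`) and every
  single ratio bounds the growth constant from below (`integral_basic_ratio_le_fSup`), every `M_σ^N I_σ(0)` bounds
  `I_σ(N)` from above (`integral_basic_le_fSup_pow`).
All for convergent bijective seatings `σ` (for non-convergent ones every `I_σ(N)` is the junk value `0`).  Standard
axioms only.
-/

noncomputable section

open MeasureTheory Set Finset Filter Topology

namespace Summit.KontsevichZagierPeriods.Zeta5Search.Families.Cellular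

variable {ℓ : ℕ} (σ : Fin (ℓ + 3) → Fin (ℓ + 3))

/-! ### Log-convexity -/

/-- Pointwise: `f_σ^{N+2} ω_σ − 2c f_σ^{N+1} ω_σ + c² f_σ^N ω_σ = f_σ^N ω_σ · (f_σ − c)²`. -/
theorem basic_quad_eq (N : ℕ) (c : ℝ) (t : Fin ℓ → ℝ) :
    c ^ 2 * basic σ (N : ℤ) t - 2 * c * basic σ ((N + 1 : ℕ) : ℤ) t + basic σ ((N + 2 : ℕ) : ℤ) t =
      basic σ (N : ℤ) t * (fSigma σ t - c) ^ 2 := by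
  rw [basic_natCast_eq, basic_natCast_eq, basic_natCast_eq]
  ring

/-- **`c² I_σ(N) − 2c I_σ(N+1) + I_σ(N+2) ≥ 0`** for every real `c` (convergent bijective seating): the left side is
`∫ f_σ^N (f_σ − c)² ω_σ`. -/
theorem integral_basic_quad_nonneg (hσ : Function.Bijective σ) (hc : Convergent σ) (N : ℕ) (c : ℝ) :
    0 ≤ c ^ 2 * integral σ (fun _ => (N : ℤ)) (fun _ => (N : ℤ))
      - 2 * c * integral σ (fun _ => ((N + 1 : ℕ) : ℤ)) (fun _ => ((N + 1 : ℕ) : ℤ))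
      + integral σ (fun _ => ((N + 2 : ℕ) : ℤ)) (fun _ => ((N + 2 : ℕ) : ℤ)) := by
  have h0 : Integrable (basic σ (N : ℤ)) (volume.restrict (openSimplex ℓ)) :=
    integrableOn_basic_of_convergent σ hσ hc (Int.natCast_nonneg N)
  have h1 : Integrable (basic σ ((N + 1 : ℕ) : ℤ)) (volume.restrict (openSimplex ℓ)) :=
    integrableOn_basic_of_convergent σ hσ hc (Int.natCast_nonneg _)
  have h2 : Integrable (basic σ ((N + 2 : ℕ) : ℤ)) (volume.restrict (openSimplex ℓ)) :=
    integrableOn_basic_of_convergent σ hσ hc (Int.natCast_nonneg _)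
  have hI : c ^ 2 * integral σ (fun _ => (N : ℤ)) (fun _ => (N : ℤ))
      - 2 * c * integral σ (fun _ => ((N + 1 : ℕ) : ℤ)) (fun _ => ((N + 1 : ℕ) : ℤ))
      + integral σ (fun _ => ((N + 2 : ℕ) : ℤ)) (fun _ => ((N + 2 : ℕ) : ℤ)) =
      ∫ t in openSimplex ℓ, basic σ (N : ℤ) t * (fSigma σ t - c) ^ 2 := by
    have e : ∫ t in openSimplex ℓ, basic σ (N : ℤ) t * (fSigma σ t - c) ^ 2 =
        ∫ t in openSimplex ℓ, (c ^ 2 * basic σ (N : ℤ) t - 2 * c * basic σ ((N + 1 : ℕ) : ℤ) t +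
          basic σ ((N + 2 : ℕ) : ℤ) t) :=
      integral_congr_ae (ae_of_all _ fun t => (basic_quad_eq σ N c t).symm)
    have hA : Integrable (fun t => c ^ 2 * basic σ (N : ℤ) t) (volume.restrict (openSimplex ℓ)) := h0.const_mul _
    have hB : Integrable (fun t => 2 * c * basic σ ((N + 1 : ℕ) : ℤ) t) (volume.restrict (openSimplex ℓ)) :=
      h1.const_mul _
    have s1 : ∫ t in openSimplex ℓ, (c ^ 2 * basic σ (N : ℤ) t - 2 * c * basic σ ((N + 1 : ℕ) : ℤ) t +
          basic σ ((N + 2 : ℕ) : ℤ) t) =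
        (∫ t in openSimplex ℓ, (c ^ 2 * basic σ (N : ℤ) t - 2 * c * basic σ ((N + 1 : ℕ) : ℤ) t)) +
          ∫ t in openSimplex ℓ, basic σ ((N + 2 : ℕ) : ℤ) t := integral_add (hA.sub hB) h2
    have s2 : ∫ t in openSimplex ℓ, (c ^ 2 * basic σ (N : ℤ) t - 2 * c * basic σ ((N + 1 : ℕ) : ℤ) t) =
        (∫ t in openSimplex ℓ, c ^ 2 * basic σ (N : ℤ) t) -
          ∫ t in openSimplex ℓ, 2 * c * basic σ ((N + 1 : ℕ) : ℤ) t :=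
      integral_sub hA hB
    have s3 : ∫ t in openSimplex ℓ, c ^ 2 * basic σ (N : ℤ) t = c ^ 2 * ∫ t in openSimplex ℓ, basic σ (N : ℤ) t :=
      integral_const_mul _ _
    have s4 : ∫ t in openSimplex ℓ, 2 * c * basic σ ((N + 1 : ℕ) : ℤ) t =
        2 * c * ∫ t in openSimplex ℓ, basic σ ((N + 1 : ℕ) : ℤ) t := integral_const_mul _ _
    rw [e, s1, s2, s3, s4]
    rfl
  rw [hI]
  exact setIntegral_nonneg (measurableSet_openSimplex ℓ) fun t ht =>
    mul_nonneg (integrand_pos hσ.1 _ _ ht).le (sq_nonneg _)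

/-- **Log-convexity**: `I_σ(N+1)² ≤ I_σ(N) · I_σ(N+2)` for a convergent bijective seating. -/
theorem integral_basic_sq_le_mul (hσ : Function.Bijective σ) (hc : Convergent σ) (N : ℕ) :
    integral σ (fun _ => ((N + 1 : ℕ) : ℤ)) (fun _ => ((N + 1 : ℕ) : ℤ)) ^ 2 ≤
      integral σ (fun _ => (N : ℤ)) (fun _ => (N : ℤ)) *
        integral σ (fun _ => ((N + 2 : ℕ) : ℤ)) (fun _ => ((N + 2 : ℕ) : ℤ)) := by
  set A := integral σ (fun _ => (N : ℤ)) (fun _ => (N : ℤ)) with hA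
  set B := integral σ (fun _ => ((N + 1 : ℕ) : ℤ)) (fun _ => ((N + 1 : ℕ) : ℤ)) with hB
  set C := integral σ (fun _ => ((N + 2 : ℕ) : ℤ)) (fun _ => ((N + 2 : ℕ) : ℤ)) with hC
  have hApos : 0 < A := integral_basic_pos σ hσ hc N
  -- evaluate the non-negative quadratic at `c = B / A`
  have h := integral_basic_quad_nonneg σ hσ hc N (B / A)
  rw [← hA, ← hB, ← hC] at h
  have h' : 0 ≤ A * ((B / A) ^ 2 * A - 2 * (B / A) * B + C) := mul_nonneg hApos.le h
  have hcalc : A * ((B / A) ^ 2 * A - 2 * (B / A) * B + C) = A * C - B ^ 2 := by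
    field_simp
    ring
  linarith [hcalc ▸ h']

/-! ### The ratios `I_σ(N+1)/I_σ(N)` -/

/-- **The ratios `I_σ(N+1)/I_σ(N)` are non-decreasing** (convergent bijective seating). -/
theorem integral_basic_ratio_mono (hσ : Function.Bijective σ) (hc : Convergent σ) :
    Monotone fun N : ℕ => integral σ (fun _ => ((N + 1 : ℕ) : ℤ)) (fun _ => ((N + 1 : ℕ) : ℤ)) /
      integral σ (fun _ => (N : ℤ)) (fun _ => (N : ℤ)) := by
  refine monotone_nat_of_le_succ fun N => ?_
  have hA := integral_basic_pos σ hσ hc N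
  have hB := integral_basic_pos σ hσ hc (N + 1)
  have h := integral_basic_sq_le_mul σ hσ hc N
  rw [div_le_div_iff₀ hA hB]
  have e2 : ((N + 1 + 1 : ℕ) : ℤ) = ((N + 2 : ℕ) : ℤ) := by push_cast; ring
  simp only [e2]
  nlinarith [h]

/-- **Each ratio is a lower bound for the growth constant**: `I_σ(N+1)/I_σ(N) ≤ M_σ`. -/
theorem integral_basic_ratio_le_fSup (hσ : Function.Bijective σ) (hc : Convergent σ) (N : ℕ) :
    integral σ (fun _ => ((N + 1 : ℕ) : ℤ)) (fun _ => ((N + 1 : ℕ) : ℤ)) /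
      integral σ (fun _ => (N : ℤ)) (fun _ => (N : ℤ)) ≤ fSup σ := by
  have hA := integral_basic_pos σ hσ hc N
  rw [div_le_iff₀ hA]
  have h0 : Integrable (basic σ (N : ℤ)) (volume.restrict (openSimplex ℓ)) :=
    integrableOn_basic_of_convergent σ hσ hc (Int.natCast_nonneg N)
  have h1 : Integrable (basic σ ((N + 1 : ℕ) : ℤ)) (volume.restrict (openSimplex ℓ)) :=
    integrableOn_basic_of_convergent σ hσ hc (Int.natCast_nonneg _)
  unfold integral
  rw [← integral_const_mul]
  refine setIntegral_mono_on h1 (h0.const_mul _) (measurableSet_openSimplex ℓ) fun t ht => ?_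
  change basic σ ((N + 1 : ℕ) : ℤ) t ≤ fSup σ * basic σ (N : ℤ) t
  rw [basic_natCast_eq, basic_natCast_eq, pow_succ, mul_comm (fSigma σ t ^ N), mul_assoc]
  exact mul_le_mul_of_nonneg_right (fSigma_le_fSup σ hσ ht)
    (mul_nonneg (pow_nonneg (fSigma_pos σ hσ.1 ht).le N) (integrand_pos hσ.1 _ _ ht).le)

/-- The ratios are positive. -/
theorem integral_basic_ratio_pos (hσ : Function.Bijective σ) (hc : Convergent σ) (N : ℕ) :
    0 < integral σ (fun _ => ((N + 1 : ℕ) : ℤ)) (fun _ => ((N + 1 : ℕ) : ℤ)) /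
      integral σ (fun _ => (N : ℤ)) (fun _ => (N : ℤ)) :=
  div_pos (integral_basic_pos σ hσ hc (N + 1)) (integral_basic_pos σ hσ hc N)

/-- `I_σ(N) ≤ I_σ(0) · L^N` whenever every ratio `I_σ(k+1)/I_σ(k)`, `k < N`, is at most `L`. -/
theorem integral_basic_le_mul_pow_of_ratio_le (hσ : Function.Bijective σ) (hc : Convergent σ) {L : ℝ}
    (hL : ∀ k : ℕ, integral σ (fun _ => ((k + 1 : ℕ) : ℤ)) (fun _ => ((k + 1 : ℕ) : ℤ)) /
      integral σ (fun _ => (k : ℤ)) (fun _ => (k : ℤ)) ≤ L) (N : ℕ) :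
    integral σ (fun _ => (N : ℤ)) (fun _ => (N : ℤ)) ≤
      integral σ (fun _ => ((0 : ℕ) : ℤ)) (fun _ => ((0 : ℕ) : ℤ)) * L ^ N := by
  induction N with
  | zero => simp
  | succ N ih =>
    have hA := integral_basic_pos σ hσ hc N
    have hLN : 0 ≤ L := (integral_basic_ratio_pos σ hσ hc 0).le.trans (hL 0)
    have h1 : integral σ (fun _ => ((N + 1 : ℕ) : ℤ)) (fun _ => ((N + 1 : ℕ) : ℤ)) ≤
        L * integral σ (fun _ => (N : ℤ)) (fun _ => (N : ℤ)) := by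
      have := hL N
      rwa [div_le_iff₀ hA] at this
    calc integral σ (fun _ => ((N + 1 : ℕ) : ℤ)) (fun _ => ((N + 1 : ℕ) : ℤ))
        ≤ L * integral σ (fun _ => (N : ℤ)) (fun _ => (N : ℤ)) := h1
      _ ≤ L * (integral σ (fun _ => ((0 : ℕ) : ℤ)) (fun _ => ((0 : ℕ) : ℤ)) * L ^ N) :=
          mul_le_mul_of_nonneg_left ih hLN
      _ = integral σ (fun _ => ((0 : ℕ) : ℤ)) (fun _ => ((0 : ℕ) : ℤ)) * L ^ (N + 1) := by ring

/-- If every ratio is at most `L`, then `M_σ ≤ L` (by the root asymptotics `I_σ(N)^{1/N} → M_σ`). -/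
theorem fSup_le_of_ratio_le (hσ : Function.Bijective σ) (hc : Convergent σ) {L : ℝ}
    (hL : ∀ k : ℕ, integral σ (fun _ => ((k + 1 : ℕ) : ℤ)) (fun _ => ((k + 1 : ℕ) : ℤ)) /
      integral σ (fun _ => (k : ℤ)) (fun _ => (k : ℤ)) ≤ L) : fSup σ ≤ L := by
  have hL0 : 0 < L := (integral_basic_ratio_pos σ hσ hc 0).trans_le (hL 0)
  have hI0 := integral_basic_pos σ hσ hc 0
  -- `I(N)^{1/N} ≤ L · I(0)^{1/N} → L`
  refine le_of_tendsto_of_tendsto (tendsto_integral_basic_root σ hσ hc) (tendsto_const_mul_root L hI0) ?_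
  filter_upwards [eventually_ne_atTop 0] with N hN
  rw [← root_pow_mul hL0.le hI0.le hN]
  refine Real.rpow_le_rpow (integral_basic_pos σ hσ hc N).le ?_ (by positivity)
  rw [mul_comm]
  exact integral_basic_le_mul_pow_of_ratio_le σ hσ hc hL N

/-- **The ratio limit**: `I_σ(N+1)/I_σ(N) → M_σ` for a convergent bijective seating (monotone and bounded by
`M_σ`, and its supremum `L` satisfies `M_σ ≤ L` by `fSup_le_of_ratio_le`). -/
theorem tendsto_integral_basic_ratio (hσ : Function.Bijective σ) (hc : Convergent σ) :
    Tendsto (fun N : ℕ => integral σ (fun _ => ((N + 1 : ℕ) : ℤ)) (fun _ => ((N + 1 : ℕ) : ℤ)) /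
      integral σ (fun _ => (N : ℤ)) (fun _ => (N : ℤ))) atTop (𝓝 (fSup σ)) := by
  set r : ℕ → ℝ := fun N => integral σ (fun _ => ((N + 1 : ℕ) : ℤ)) (fun _ => ((N + 1 : ℕ) : ℤ)) /
      integral σ (fun _ => (N : ℤ)) (fun _ => (N : ℤ)) with hr
  have hbdd : BddAbove (Set.range r) := ⟨fSup σ, by rintro _ ⟨N, rfl⟩; exact integral_basic_ratio_le_fSup σ hσ hc N⟩
  have hmono : Monotone r := integral_basic_ratio_mono σ hσ hc
  have hlim : Tendsto r atTop (𝓝 (⨆ N, r N)) := tendsto_atTop_ciSup hmono hbdd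
  have hle : (⨆ N, r N) ≤ fSup σ := ciSup_le fun N => integral_basic_ratio_le_fSup σ hσ hc N
  have hge : fSup σ ≤ ⨆ N, r N := fSup_le_of_ratio_le σ hσ hc fun k => le_ciSup hbdd k
  rw [le_antisymm hle hge] at hlim
  exact hlim

/-- **`M_σ = sup_N I_σ(N+1)/I_σ(N)`** for a convergent bijective seating: the growth constant is the supremum of
the (non-decreasing) ratio sequence. -/
theorem fSup_eq_ciSup_ratio (hσ : Function.Bijective σ) (hc : Convergent σ) :
    fSup σ = ⨆ N : ℕ, integral σ (fun _ => ((N + 1 : ℕ) : ℤ)) (fun _ => ((N + 1 : ℕ) : ℤ)) /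
      integral σ (fun _ => (N : ℤ)) (fun _ => (N : ℤ)) :=
  tendsto_nhds_unique (tendsto_integral_basic_ratio σ hσ hc)
    (tendsto_atTop_ciSup (integral_basic_ratio_mono σ hσ hc)
      ⟨fSup σ, by rintro _ ⟨N, rfl⟩; exact integral_basic_ratio_le_fSup σ hσ hc N⟩)

end Summit.KontsevichZagierPeriods.Zeta5Search.Families.Cellular
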